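import Summits.ResolutionOfSingularities.ResolutionOfSingularities.Theorems.EquisingularLiftEquisingularLiftNatDirLiftUnobsAssembly
import HarnessLib

/-!
# [OURS · L1 W4.5(b) · research residue `three_isolated_nonConeTower`, brick R1] From the bridge identity `Φ^*[𝒞]·[F] = [L]²` to
# `Φ^*[𝒩] = [𝓗om(L, Q)]`, abstractly

Cell `res-hironaka`, LADDER-RESOLUTION rung L (D-0089), slot W4.5(b), crux chain w45b: working crux
`Theses.EquisingularLift.EquisingularLiftNat` (stmt-ResolutionOfSingularities-20038) / child `EquisingularLiftNatThree`
(stmt-ResolutionOfSingularities-20148); research residue `stub_elnat_three_isolated_nonConeTower` of CHILD skeleton v23/v24, res-type-027's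
RESIDUE-1 census (`Cruxes/EquisingularLiftNatThree/Lines/RESIDUE1-CENSUS-res-type-027.md`, sigs `L/res-type-027/RESIDUE1-pieces.sig.lean`
9b43e988a6b2b6d3), brick **R1**, taken by signature by res-L1-w45b-stub-2 g9 (027 naming «stub-2?», STATUS l.≈77999; TAKING l.≈78003).
`--supports stmt-ResolutionOfSingularities-20148 --as helper`. OURS; NOT a statement of any manuscript; AI-written, and AI review is weaker than
expert review. No `sorry`, standard axioms, DEF-FREE.

WHAT. **`cechPic_pullback_detClass_normalSheaf_of_sq`** — the `HasRank`/`detClass` RESTATEMENT of the C2 keystone (★)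
(`cechPic_pullback_detClass_conormal_section`, p592436) in ABSTRACT form, reusable by every rung that consumes an `hcl` (multisection rounds
included, census (b)): for a closed immersion `i₁ : Γ̃ ⟶ Ẽ` whose conormal sheaf `𝒞` is a line bundle, an isomorphism `Φ : Y ≅ Γ̃`, and a short
exact `0 → L → F → Q → 0` on `Y` with `rk L = 1`, `rk F = 2`, `Q` finite locally free: if `Φ^*[det 𝒞]·[det F] = [det L]²` then the normal
sheaf `𝒩 = 𝒞^∨` has rank one and `Φ^*[det 𝒩] = [det 𝓗om(L, Q)]` — the `hcl` of B3-TRANSFER `subsingleton_cechMH1_Dplus_of_iso_of_detClass_eq`.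
Pure class bookkeeping: `[𝒩] = [𝒞]⁻¹` (plumbing `detClass_dual_eq_inv`), `rk Q = 1` (B2′ `hasRank_X₃_one_of_shortExact`),
`[𝓗om(L, Q)] = [F]·[L]⁻²` (B2 `detClass_sheafHom_eq_of_shortExact`), group algebra (lead-2's `cechPic_pullback_eq_of_bridge`).

References (index only): R. Hartshorne, *Algebraic Geometry* (1977), III Ex. 4.5, II Ex. 5.16 (d), II Ex. 6.11 [cite: Hartshorne1977].
-/

noncomputable section

-- `TopCat.Presheaf`/`Scheme.Modules` are not reducible (as in Mathlib's `AlgebraicGeometry/Modules`).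
set_option backward.isDefEq.respectTransparency false

open CategoryTheory CategoryTheory.Limits AlgebraicGeometry TopologicalSpace
open Literature.AlgebraicGeometry.Modules Literature.AlgebraicGeometry.Motives Literature.AlgebraicGeometry.HodgeTheory
open Literature.AlgebraicGeometry.Morphisms Literature.AlgebraicGeometry.Deformation

set_option linter.dupNamespace false -- mandated namespace `Summit.<Summit>.<Problem>` of this single-conjunct summit

namespace Summit.ResolutionOfSingularities.ResolutionOfSingularities.Cruxes.EquisingularLiftNat.Sections

/-- **R1 — from (★)'s class identity to the `hcl` of B3-TRANSFER, abstractly**: `i₁ : Γ̃ ⟶ Ẽ` with conormal LINE bundle `𝒞`, `Φ : Y ≅ Γ̃`,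
`0 → L → F → Q → 0` short exact on `Y` with `rk L = 1`, `rk F = 2`, `Q` finite locally free, and `Φ^*[det 𝒞]·[det F] = [det L]²` ⇒ the normal
sheaf `𝒩 = 𝒞^∨` has rank one and `Φ^*[det 𝒩] = [det 𝓗om(L, Q)]`. [cite: Hartshorne1977, III Ex. 4.5 (classes of line bundles in Ȟ¹(X, 𝒪^×))] -/
theorem cechPic_pullback_detClass_normalSheaf_of_sq {Y Γt Et : Scheme.{0}} (i₁ : Γt ⟶ Et) (Φ : Y ≅ Γt)
    {L F Q : Y.Modules} {S : ShortComplex Y.Modules} (hS : S.ShortExact) (hS₁ : S.X₁ = L) (hS₂ : S.X₂ = F) (hS₃ : S.X₃ = Q)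
    (hL1 : HasRank L 1) (hF2 : HasRank F 2) (hQf : IsFiniteLocallyFree Q)
    (h𝒞1 : HasRank (conormalSheaf i₁) 1)
    (hstar : ∀ (h𝒞 : IsFiniteLocallyFree (conormalSheaf i₁)) (hF : IsFiniteLocallyFree F) (hL : IsFiniteLocallyFree L),
      CechPic.pullback Φ.hom (detClass h𝒞) * detClass hF = detClass hL ^ 2) :
    HasRank (normalSheaf i₁) 1 ∧
      ∀ (hN : IsFiniteLocallyFree (normalSheaf i₁)) (hH : IsFiniteLocallyFree (sheafHom L Q)),
        CechPic.pullback Φ.hom (detClass hN) = detClass hH := by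
  subst hS₁ hS₂ hS₃
  -- the conormal line bundle and the normal line bundle `𝒩 = 𝒞^∨`, `[𝒩] = [𝒞]⁻¹`
  have h𝒞f : IsFiniteLocallyFree (conormalSheaf i₁) := isFiniteLocallyFree_of_hasRank h𝒞1
  have hNf : IsFiniteLocallyFree (normalSheaf i₁) := isFiniteLocallyFree_dual_of_hasRank_one h𝒞1
  obtain ⟨hN1, hNcl⟩ := detClass_dual_eq_inv h𝒞1 h𝒞f hNf
  refine ⟨hN1, fun hN hH => ?_⟩
  -- the `Q`-side: `rk Q = 1`, `[𝓗om(L, Q)] = [F]·[L]⁻²`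
  have hLf : IsFiniteLocallyFree S.X₁ := isFiniteLocallyFree_of_hasRank hL1
  have hFf : IsFiniteLocallyFree S.X₂ := isFiniteLocallyFree_of_hasRank hF2
  have hQ1 : HasRank S.X₃ 1 := hasRank_X₃_one_of_shortExact hS hL1 hF2 hQf
  have hHcl : detClass hH = detClass hFf * (detClass hLf ^ 2)⁻¹ := detClass_sheafHom_eq_of_shortExact hS hL1 hQ1 hLf hFf hQf hH
  -- group algebra
  rw [detClass_congr hN hNf]
  exact cechPic_pullback_eq_of_bridge Φ.hom (detClass h𝒞f) (detClass hNf) (detClass hFf) (detClass hLf) (detClass hH)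
    (hstar h𝒞f hFf hLf) hNcl hHcl

end Summit.ResolutionOfSingularities.ResolutionOfSingularities.Cruxes.EquisingularLiftNat.Sections

end
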